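import Summits.Ventures.PercRepro.MSRMStarEdges
import Summits.Ventures.PercRepro.MSRMStarCex

/-!
# THEOREM (RM*) — the residue statement of Addendum 28 (proofs/MINE1-theoremS.md, Addendum 35)

In the setting `RMStar r F u₀` (excess one, `{r} ∈ F`, `∅ ∉ F`, a tight trace with all
singletons, monotone labelling, the near-member data (H2)–(H4) at `u₀`) **every `r`-lifted face
is `∅` or a member avoiding `r`**: `partr r F ⊆ insert ∅ (part0 r F)`
(`RMStar.partr_subset_insert_empty`, explicit form `partr_subset_insert_empty_of_rmstar`). With
Lemma R this is the block form of Conjecture V at `r`: `F \\ F = insert ∅ F`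
(`diffs_eq_insert_empty_of_rmstar`).

**Proof.** A counterexample has `r`-only singletons `y₀ ∈ u₀`, `z₀ ∈ ū` (R3), the A-only
member `s*` is a partner member inside `ū` (`MSRMStarCex.lean`), and `|Y| = |K| + 1` with
`D(K) ⊆ Y`. Let `k ⊆ ū` be a partner member of minimum size and `A := ū ∖ k ≠ ∅`, a type-I
difference.
* *Case E* (`K` of excess one, `Y = D(K)`; `not_of_excess_partner`): if some `z ∈ A` is a
  non-tightening direction of `K`, Lemma (UC) produces a partner member containing `ū`, so `ū` is
  `r`-lifted — against (H2). Otherwise every `z ∈ A` is tightening for `K`, hence for `F`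
  (the comparison lemma), hence not `r`-only (Lemma 3), so `{z}` is a partner member inside `ū`;
  minimality makes `k` a singleton `{z₁}` with `{z₁} ∈ F₀`, and `z₀ ∈ ū` is then a member
  singleton — against its choice.
* *Case T* (`K` tight, `Y = D(K) ⊔ {e₀}`; `not_of_tight_partner`): every direction is
  non-tightening for `K`, so `A ∉ D(K)` (else Lemma (UC) at a `z ∈ A` with `{z} ∈ D(K)`), i.e.
  `A = e₀`. With `ρ = Rstar K ∈ K` and `D(K) = K ∆ ρ` (Theorem S): `ρ` meets `u₀` (else the partner
  member `q_{z₀} ⊆ u₀` is a union of removable classes and `∅ ∈ K`) and `ρ ⊉ u₀` (down-set), so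
  `e' := u₀ ∖ ρ` is a nonempty proper face of `u₀`, `r`-lifted by Claim 1, hence
  `e' = e' ∖ ρ ∈ Y`; `e' ∉ D(K)` (a `k ∆ ρ = e'` would give `k ⊇ u₀`), so `e' = e₀ = A ⊆ ū` —
  but `e' ⊆ u₀` is disjoint from `ū`.
-/

namespace PercRepro.MSTight

open Finset
open scoped FinsetFamily symmDiff

variable {α : Type*} [DecidableEq α] [Fintype α]

namespace RMStar

variable {r : α} {F : Finset (Finset α)} {u₀ : Finset α}

/-- A partner member of minimum size inside `ū` exists (the A-only member is one). -/
theorem exists_min_partner_subset_ubar (h : RMStar r F u₀) {y₀ : α} (hy₀ : y₀ ∈ u₀)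
    (hy₀0 : ({y₀} : Finset α) ∉ part0 r F) {s : Finset α} (hs : s ∈ part0 r F)
    (hs4 : u₀ \ s ∉ diffsY r F) :
    ∃ k ∈ partner r F, k ⊆ ubar r u₀ ∧ ∀ k' ∈ partner r F, k' ⊆ ubar r u₀ → k.card ≤ k'.card := by
  have hne : ((partner r F).filter (fun k => k ⊆ ubar r u₀)).Nonempty :=
    ⟨s, mem_filter.2 ⟨h.aonly_mem_partner hy₀ hy₀0 hs hs4, h.aonly_subset_ubar hy₀ hy₀0 hs hs4⟩⟩
  obtain ⟨k, hk, hmin⟩ := Finset.exists_min_image _ Finset.card hne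
  rw [mem_filter] at hk
  exact ⟨k, hk.1, hk.2, fun k' hk' hk'U => hmin k' (mem_filter.2 ⟨hk', hk'U⟩)⟩

/-- `ū ∖ k ≠ ∅` for a partner member `k ⊆ ū` (`ū` itself is not `r`-lifted). -/
theorem sdiff_nonempty_of_subset_ubar (h : RMStar r F u₀) {k : Finset α} (hk : k ∈ partner r F)
    (hkU : k ⊆ ubar r u₀) : (ubar r u₀ \ k).Nonempty := by
  rw [nonempty_iff_ne_empty]
  intro he
  rw [sdiff_eq_empty_iff_subset] at he
  have : k = ubar r u₀ := Subset.antisymm hkU he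
  exact h.ubar_notMem (this ▸ (mem_inter.1 hk).2)

/-- A partner member containing `ū` makes `ū` `r`-lifted — impossible. -/
theorem not_exists_superset_ubar (h : RMStar r F u₀) {m : Finset α} (hm : m ∈ partner r F)
    (hUm : ubar r u₀ ⊆ m) : False := by
  have hmP : ubar r u₀ ∈ proj r F :=
    h.mem_proj_of_subset' (mem_proj_of_mem_partr (mem_inter.1 hm).2) hUm
  exact h.ubar_notMem (h.down m (mem_inter.1 hm).2 _ hmP hUm)

/-- `{z} ∈ D(K)` makes the partner family of `K` at `z` nonempty (the `z`-edge `∅, {z}` of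
`D(K)`). -/
theorem partner_partner_nonempty (h : RMStar r F u₀) {z : α}
    (hε : (diffsX z (partner r F) ∩ diffsY z (partner r F)).card =
      (partner z (partner r F)).card)
    (hne : (partner r F).Nonempty)
    (hz : ({z} : Finset α) ∈ partner r F \\ partner r F) : (partner z (partner r F)).Nonempty := by
  have _ := h.exc
  obtain ⟨k, hk⟩ := hne
  have h0 : (∅ : Finset α) ∈ partner r F \\ partner r F :=
    Finset.mem_diffs.2 ⟨k, hk, k, hk, Finset.sdiff_self k⟩
  have hmem : (∅ : Finset α) ∈ partner z (partner r F \\ partner r F) :=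
    mem_partner_iff.2 ⟨h0, notMem_empty z, by simpa using hz⟩
  rw [← diffsX_inter_diffsY_eq_partner_diffs] at hmem
  rw [← card_pos, ← hε]
  exact card_pos.2 ⟨∅, hmem⟩

/-- **Claim 2.** The case «`K` of excess one, `Y = D(K)`» is impossible. -/
theorem not_of_excess_partner (h : RMStar r F u₀) {y₀ : α} (hy₀ : y₀ ∈ u₀)
    (hy₀0 : ({y₀} : Finset α) ∉ part0 r F) {z₀ : α} (hz₀ : z₀ ∈ ubar r u₀)
    (hz₀0 : ({z₀} : Finset α) ∉ part0 r F) {s : Finset α} (hs : s ∈ part0 r F)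
    (hs4 : u₀ \ s ∉ diffsY r F)
    (hK : (partner r F \\ partner r F).card = (partner r F).card + 1)
    (hY : diffsY r F = partner r F \\ partner r F) : False := by
  obtain ⟨k, hkK, hkU, hmin⟩ := h.exists_min_partner_subset_ubar hy₀ hy₀0 hs hs4
  have hAY := h.sdiff_mem_diffsY_of_subset_ubar hy₀ hy₀0 hkK hkU
  have hA : ubar r u₀ \ k ∈ partner r F \\ partner r F := by rwa [hY] at hAY
  have hAne := h.sdiff_nonempty_of_subset_ubar hkK hkU
  by_cases hex : ∃ z ∈ ubar r u₀ \ k, ¬ Tight (proj z (partner r F))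
  · -- a non-tightening direction of `K` inside `A`: Lemma (UC)
    obtain ⟨z, hz, hnt⟩ := hex
    have hzr : z ≠ r := (mem_ubar.1 (mem_sdiff.1 hz).1).1
    have hε : (diffsX z (partner r F) ∩ diffsY z (partner r F)).card =
        (partner z (partner r F)).card := by
      have h1 := card_diffs_eq_card_diffs_proj_add z (partner r F)
      have h2 := card_eq_card_proj_add_card_partner z (partner r F)
      have h3 := Finset.card_le_card_diffs (proj z (partner r F))
      have h4 := card_partner_le_card_edges_diffs z (partner r F)
      unfold Tight at hnt
      omega
    have hz1 : ({z} : Finset α) ∈ partner r F \\ partner r F := by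
      rw [← hY]; exact h.singleton_mem_diffsY hy₀ hy₀0 hz₀ hz₀0 hs hs4 hzr
    have hKz := h.partner_partner_nonempty hε ⟨k, hkK⟩ hz1
    obtain ⟨m, hmK, hUm⟩ := exists_superset_mem_of_min_mem_subset hkK hkU hmin hA hz hε hKz
    exact h.not_exists_superset_ubar hmK hUm
  · -- every direction inside `A` is tightening for `K`, hence for `F`, hence a member singleton
    have hall : ∀ z ∈ ubar r u₀ \ k, Tight (proj z (partner r F)) := by
      intro z hz
      by_contra hnt
      exact hex ⟨z, hz, hnt⟩
    have hsing : ∀ z ∈ ubar r u₀ \ k, ({z} : Finset α) ∈ part0 r F := by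
      intro z hz
      by_contra hz0
      have hzU : z ∈ ubar r u₀ := (mem_sdiff.1 hz).1
      have hzr : z ≠ r := (mem_ubar.1 hzU).1
      exact h.not_tight_proj_of_mem_ubar hzU hz0
        (tight_proj_of_tight_proj_partner h.exc h.tightP h.singleton_mem hY hK hzr (hall z hz))
    obtain ⟨z, hz⟩ := hAne
    have hzK : ({z} : Finset α) ∈ partner r F :=
      h.singleton_mem_partner_of_mem_part0 hy₀ hy₀0 (hsing z hz)
    have hk1 : k.card ≤ 1 := by
      have := hmin {z} hzK (singleton_subset_iff.2 (mem_sdiff.1 hz).1)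
      simpa using this
    have hkne : k.Nonempty := by
      rw [nonempty_iff_ne_empty]
      rintro rfl
      exact h.empty_notMem (mem_of_mem_partner hkK)
    obtain ⟨z₁, hz₁⟩ := card_eq_one.1 (le_antisymm hk1 (card_pos.2 hkne))
    by_cases hz₀k : z₀ ∈ k
    · rw [hz₁, mem_singleton] at hz₀k
      subst hz₀k
      exact hz₀0 (hz₁ ▸ (mem_inter.1 hkK).1)
    · exact hz₀0 (hsing z₀ (mem_sdiff.2 ⟨hz₀, hz₀k⟩))

/-- **Claim 3.** The case «`K` tight, `Y = D(K) ⊔ {e₀}`» is impossible. -/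
theorem not_of_tight_partner (h : RMStar r F u₀) {y₀ : α} (hy₀ : y₀ ∈ u₀)
    (hy₀0 : ({y₀} : Finset α) ∉ part0 r F) {z₀ : α} (hz₀ : z₀ ∈ ubar r u₀)
    (hz₀0 : ({z₀} : Finset α) ∉ part0 r F) {s : Finset α} (hs : s ∈ part0 r F)
    (hs4 : u₀ \ s ∉ diffsY r F) (hT : Tight (partner r F)) {e₀ : Finset α}
    (hY : diffsY r F = insert e₀ (partner r F \\ partner r F)) : False := by
  obtain ⟨k, hkK, hkU, hmin⟩ := h.exists_min_partner_subset_ubar hy₀ hy₀0 hs hs4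
  have hAY := h.sdiff_mem_diffsY_of_subset_ubar hy₀ hy₀0 hkK hkU
  have hAne := h.sdiff_nonempty_of_subset_ubar hkK hkU
  -- every direction is non-tightening for the tight `K`
  have hε : ∀ z, (diffsX z (partner r F) ∩ diffsY z (partner r F)).card =
      (partner z (partner r F)).card := by
    intro z
    obtain ⟨_, hKz, heq⟩ := tight_proj_and_partner (r := z) hT
    rw [heq]
    exact hKz
  -- Step 1: `A ∉ D(K)`, so `A = e₀`
  have hAnot : ubar r u₀ \ k ∉ partner r F \\ partner r F := by
    intro hAD
    have hzD : ∃ z ∈ ubar r u₀ \ k, ({z} : Finset α) ∈ partner r F \\ partner r F := by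
      by_contra hcon
      have hall : ∀ z ∈ ubar r u₀ \ k, ({z} : Finset α) = e₀ := by
        intro z hz
        have hzr : z ≠ r := (mem_ubar.1 (mem_sdiff.1 hz).1).1
        have hzY := h.singleton_mem_diffsY hy₀ hy₀0 hz₀ hz₀0 hs hs4 hzr
        rw [hY] at hzY
        rcases mem_insert.1 hzY with hzY | hzY
        · exact hzY
        · exact absurd ⟨z, hz, hzY⟩ hcon
      obtain ⟨z, hz⟩ := hAne
      have hAeq : ubar r u₀ \ k = {z} := by
        ext w
        constructor
        · intro hw
          have h1 := hall w hw
          rw [← hall z hz] at h1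
          exact mem_singleton.2 (singleton_inj.1 h1)
        · intro hw
          rw [mem_singleton.1 hw]
          exact hz
      rw [hAeq] at hAD
      exact hcon ⟨z, hz, hAD⟩
    obtain ⟨z, hz, hzD⟩ := hzD
    have hKz := h.partner_partner_nonempty (hε z) ⟨k, hkK⟩ hzD
    obtain ⟨m, hmK, hUm⟩ :=
      exists_superset_mem_of_min_mem_subset hkK hkU hmin hAD hz (hε z) hKz
    exact h.not_exists_superset_ubar hmK hUm
  have hAe : ubar r u₀ \ k = e₀ := by
    rw [hY] at hAY
    exact (mem_insert.1 hAY).resolve_right hAnot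
  -- Step 2: Theorem S on `K`
  have hdich := dichotomy_of_tight hT
  have hρ : Rstar (partner r F) ∈ partner r F := Rstar_mem_of_dichotomy hdich ⟨k, hkK⟩
  have hflip := diffs_eq_flip_of_tight hT
  have hq := h.inter_u0_Rstar_mem_partner hz₀ hz₀0
  -- `ρ` meets `u₀`
  have hρu : (Rstar (partner r F) ∩ u₀).Nonempty := by
    rw [nonempty_iff_ne_empty]
    intro hemp
    have hrem : ∀ a ∈ u₀ ∩ Rstar (partner z₀ F),
        ClosedRem (partner r F) (cls (partner r F) a) := by
      intro a ha
      apply closedRem_of_notMem_Rstar hdich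
      intro haR
      have : a ∈ Rstar (partner r F) ∩ u₀ := mem_inter.2 ⟨haR, (mem_inter.1 ha).1⟩
      rw [hemp] at this
      exact notMem_empty a this
    have := sdiff_mem_of_closedRem (twinClosed_of_mem hq) hrem hq
    rw [sdiff_self] at this
    exact h.empty_notMem (mem_of_mem_partner this)
  -- `ρ ⊉ u₀`
  have hρu' : ¬ u₀ ⊆ Rstar (partner r F) := fun hsub =>
    h.u0_notMem (h.down _ (mem_inter.1 hρ).2 _ h.u0_mem_proj hsub)
  -- `e' = u₀ ∖ ρ` is a nonempty proper face of `u₀`, `r`-lifted by Claim 1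
  have he'ne : (u₀ \ Rstar (partner r F)).Nonempty := by
    rw [nonempty_iff_ne_empty, Ne, sdiff_eq_empty_iff_subset]
    exact hρu'
  have he'ss : u₀ \ Rstar (partner r F) ⊂ u₀ := by
    refine Finset.ssubset_iff_subset_ne.2 ⟨sdiff_subset, fun heq => ?_⟩
    obtain ⟨a, ha⟩ := hρu
    have : a ∈ u₀ \ Rstar (partner r F) := by rw [heq]; exact (mem_inter.1 ha).2
    exact (mem_sdiff.1 this).2 (mem_inter.1 ha).1
  have he'P : u₀ \ Rstar (partner r F) ∈ proj r F :=
    h.mem_proj_of_subset' h.u0_mem_proj sdiff_subset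
  have he'1 : u₀ \ Rstar (partner r F) ∈ partr r F := by
    rcases part0_or_partr he'P with h0 | h1
    · exact h.mem_partr_of_ssubset hy₀ hy₀0 he'ss h0
    · exact h1
  have he'Y : u₀ \ Rstar (partner r F) ∈ diffsY r F :=
    mem_diffsY_of_disjoint he'1 (mem_inter.1 hρ).1 sdiff_disjoint
  -- `e' ∉ D(K) = flip ρ K`
  have he'D : u₀ \ Rstar (partner r F) ∉ partner r F \\ partner r F := by
    intro hD
    rw [hflip, mem_flip_iff] at hD
    have hk' : u₀ ⊆ (u₀ \ Rstar (partner r F)) ∆ Rstar (partner r F) := by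
      intro a ha
      rw [mem_symmDiff]
      by_cases haρ : a ∈ Rstar (partner r F)
      · exact Or.inr ⟨haρ, fun hae => (mem_sdiff.1 hae).2 haρ⟩
      · exact Or.inl ⟨mem_sdiff.2 ⟨ha, haρ⟩, haρ⟩
    exact h.u0_notMem (h.down _ (mem_inter.1 hD).2 _ h.u0_mem_proj hk')
  -- so `e' = e₀ = A ⊆ ū`, against `e' ⊆ u₀`
  have he'e : u₀ \ Rstar (partner r F) = e₀ := by
    rw [hY] at he'Y
    exact (mem_insert.1 he'Y).resolve_right he'D
  obtain ⟨a, ha⟩ := he'ne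
  have ha1 : a ∈ u₀ := (mem_sdiff.1 ha).1
  have ha2 : a ∈ ubar r u₀ \ k := by rw [hAe, ← he'e]; exact ha
  exact (mem_ubar.1 (mem_sdiff.1 ha2).1).2 ha1

/-- **THEOREM (RM*).** In the setting `RMStar r F u₀`, every `r`-lifted face is `∅` or a
member avoiding `r`. -/
theorem partr_subset_insert_empty (h : RMStar r F u₀) : partr r F ⊆ insert ∅ (part0 r F) := by
  by_contra hcex
  obtain ⟨y₀, hy₀, hy₀0⟩ := h.exists_ronly_mem_u0 hcex
  obtain ⟨z₀, hz₀, hz₀0⟩ := h.exists_ronly_mem_ubar hcex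
  obtain ⟨s, hs, _, hs4⟩ := h.aonly
  rcases h.diffsY_cases with ⟨hK, hY⟩ | ⟨hT, e₀, _, _, hY⟩
  · exact h.not_of_excess_partner hy₀ hy₀0 hz₀ hz₀0 hs hs4 hK hY
  · exact h.not_of_tight_partner hy₀ hy₀0 hz₀ hz₀0 hs hs4 hT hY

end RMStar

section Explicit

variable {r : α} {F : Finset (Finset α)}

/-- **THEOREM (RM*), explicit form** (Addendum 35). `F` of excess one with `{r} ∈ F`, `∅ ∉ F`, a
tight trace containing every singleton, `F₁` a down-set and `F₀` an up-set of the trace; `u₀` a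
member avoiding `r` that is not `r`-lifted, whose complement `ū = univ ∖ insert r u₀` is not
`r`-lifted; every member `s` avoiding `r` has `ū ∖ s ∈ P` or `u₀ ∖ s ∈ Y`, and some `s*` has
`ū ∖ s* ∈ P` and `u₀ ∖ s* ∉ Y`. Then every `r`-lifted face is `∅` or a member avoiding `r`. -/
theorem partr_subset_insert_empty_of_rmstar (hF : (F \\ F).card = F.card + 1)
    (hP : Tight (proj r F)) (hr : ({r} : Finset α) ∈ F) (hE : (∅ : Finset α) ∉ F)
    (hsing : ∀ a, a ≠ r → ({a} : Finset α) ∈ proj r F)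
    (hdown : ∀ t ∈ partr r F, ∀ e ∈ proj r F, e ⊆ t → e ∈ partr r F)
    (hup : ∀ s ∈ part0 r F, ∀ e ∈ proj r F, s ⊆ e → e ∈ part0 r F)
    {u₀ : Finset α} (hu0 : u₀ ∈ part0 r F) (hu1 : u₀ ∉ partr r F)
    (hubar : Finset.univ \ insert r u₀ ∉ partr r F)
    (h3 : ∀ s ∈ part0 r F, (Finset.univ \ insert r u₀) \ s ∈ proj r F ∨ u₀ \ s ∈ diffsY r F)
    (h4 : ∃ s ∈ part0 r F, (Finset.univ \ insert r u₀) \ s ∈ proj r F ∧ u₀ \ s ∉ diffsY r F) :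
    partr r F ⊆ insert ∅ (part0 r F) :=
  RMStar.partr_subset_insert_empty
    ⟨hF, hP, hr, hE, hsing, hdown, hup, hu0, hu1, hubar, h3, h4⟩

/-- **The block form of Conjecture V at `r`** from (RM*) and Lemma R: with `univ ∉ F` and full
support, `F \\ F = insert ∅ F`. -/
theorem diffs_eq_insert_empty_of_rmstar (hF : (F \\ F).card = F.card + 1)
    (hP : Tight (proj r F)) (hr : ({r} : Finset α) ∈ F) (hE : (∅ : Finset α) ∉ F)
    (hsing : ∀ a, a ≠ r → ({a} : Finset α) ∈ proj r F)
    (hdown : ∀ t ∈ partr r F, ∀ e ∈ proj r F, e ⊆ t → e ∈ partr r F)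
    (hup : ∀ s ∈ part0 r F, ∀ e ∈ proj r F, s ⊆ e → e ∈ part0 r F)
    {u₀ : Finset α} (hu0 : u₀ ∈ part0 r F) (hu1 : u₀ ∉ partr r F)
    (hubar : Finset.univ \ insert r u₀ ∉ partr r F)
    (h3 : ∀ s ∈ part0 r F, (Finset.univ \ insert r u₀) \ s ∈ proj r F ∨ u₀ \ s ∈ diffsY r F)
    (h4 : ∃ s ∈ part0 r F, (Finset.univ \ insert r u₀) \ s ∈ proj r F ∧ u₀ \ s ∉ diffsY r F)
    (hU : (Finset.univ : Finset α) ∉ F) (hcov : ∀ x : α, ∃ t ∈ F, x ∈ t) :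
    F \\ F = insert ∅ F := by
  have htr := partr_subset_insert_empty_of_rmstar hF hP hr hE hsing hdown hup hu0 hu1 hubar h3 h4
  refine diffs_eq_insert_empty_of_trace hr ?_ hP hU hcov hF hE
  intro t ht hrt
  have h1 : t.erase r ∈ partr r F :=
    mem_partr.2 ⟨notMem_erase r t, by rw [insert_erase hrt]; exact ht⟩
  have h2 := htr h1
  rw [mem_insert] at h2
  rcases h2 with h2 | h2
  · right
    rw [← insert_erase hrt, h2]
    rfl
  · left
    exact (mem_part0.1 h2).1

end Explicit

end PercRepro.MSTight
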